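import Summits.ABC.IUTFork.Joshi.ATS4DescentSpineGenuineResidualUnsatDegOne
import Literature.IUT.LogVolume.Corollary22RatPointDictionary
import HarnessLib

/-!
# [J-IV] (arXiv:2403.10430v2) §6.10–§7.1, E5 descent spine at `d = 1`: the edge prime `ℓ = 5` — the GENUINE-COMPONENT residual is
# UNSATISFIABLE on the `ℚ`-family `ν_{m,n} = 5^m/(5^m + 7^n)` (`p₀ = 7`) at `ℓ = 5` (R-J row Y-21 PARENT (r2)/(r4); E ROW R-27)

Proof-only companion (0 defs) of the abc-iut cell, sub-cell R-J «JOSHI Y-DISCHARGE CENSUS» (rung LADDER-ABC:A2.RESCUE.J; table of record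
`HOME/plan/E/R-J/Y-CENSUS.tsv`, row Y-21 PARENT), seat abc-iut-E-t35 (gen 12), E ROW R-27 (`HOME/plan/E/R-J/E-ROWS.md` §E) part (2), `d = 1`,
`ℓ = 5`. The prime `ℓ = 5` is admissible for [IUTchI] Def. 3.1 (c) / [J-III] §3.3 (11) (`InitialThetaData.five_le_l` / `ATS3.InitialThetaData.five_le`)
though EXCLUDED by the E5 binder's `ITDConditions` (`not_itdConditions_five`, companion `…UnsatEllFive`, p497438). At `d = 2` the `∃`-body is covered
at `ℓ = 5` on `P_{a,c}` (p497438). At `d = 1` the `λ_k`-type families (`1/2 + 2/p₀^k`, one controlled pole class of share `1/3`) cannot serve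
`ℓ = 5` (failure ratio `ℓ(ℓ+1)/36 = 5/6 < 1`). THIS FILE uses instead the `ℚ`-points `ν_{m,n} := 5^m/(5^m + 7^n)` — the `ℚ`-shadow of the S-unit
template (`u = 5^m`, `v − u = 7^n`, `v = 5^m + 7^n`; poles `2m·(5) + 2n·(7) + 2·(v)`): at `ℓ = 5` the set `S = {2, ℓ}` REMOVES the `5`-class from
`log 𝔮_F`, so the `7`-share of `log q^{∤{2,5}}(ν) ≤ 2n·log 7 + 2·log(5^m + 7^n)` is `≥ 1/2 − o(1) > 12/30` once `5^m ≤ 7^n`, and the one-prime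
mechanism at `p₀ = 7 ∤ 2·46080` (tame: `ℓ = 5 ≠ 7`) bites:

* §1 a GENERIC bound for rational points: `logQAvoid_ratPoint_le_log_denom` — if `j(q) = N/D` (`N, D ≠ 0` naturals, coprimality NOT needed) and
  `s ∈ S` is prime, then `log q^{∤S}(q) ≤ log D − v_s(D)·log s` (per place `h_v = v_p(D) − v_p(N) ≤ v_p(D)`, `Cor22.ord_natCast_eq_factorization`;
  `log D = Σ_p v_p(D)·log p`, Mathlib `Real.log_nat_eq_sum_factorization`);
* §2 the point: `jInv_nu_eq` (`j(ν) = 2⁸(5^{2m} + 5^m7^n + 7^{2n})³/(5^{2m}·7^{2n}·(5^m+7^n)²)`), `ord_jInv_nu` (`ord_7 j(ν) = −2n`),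
  `logQAvoid_two_five_nu_le` (`log q^{∤{2,5}}(ν) ≤ 2n·log 7 + 2·log(5^m+7^n)`), `nu_ne`; the genuine `7`-components via `DegOne.*` (p487789):
  `q₇ = 2n·log 7` EXACTLY (`qSeven_eq`), `d₇ ≤ log 7` (`dSeven_le`), `7 ∈ V^dst_ℚ` (`exists_mem_V_residueChar_eq_seven`);
* §3 `localExcess_arith_five` (`p₀ = 7`, `d = 1`, `ℓ = 5`; linear in `n`, `n_fail ≈ 7.9·10⁶`) and **`FiveSevenResidual.genuineResidualSupport_unsat_five`**
  — the `∃`-body of p464392 §4 VERBATIM at `d := 1`, `P := ratPoint ν_{m,n}` (byte-identical, up to the point, to the body negated in p488306),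
  under `ℓ = 5`, FALSE for `n ≥ 10⁷`, `5^m ≤ 7^n` (any `m`).

With p488306 (`λ_k`, `ℓ ≥ 11`) and `…UnsatDegOneEleven` (`μ_k`, `ℓ ≥ 7`, `ℓ ≠ 11`) the `d = 1` small print now covers EVERY prime `ℓ ≥ 5`, each on a
named `ℚ`-family (on paper, not needed here: the sub-family `m, n` even, `1/3 ≤ 5^m/7^n ≤ 3` lies in `K_V = CBData.std {2}` — `|ν − 1/2| ≤ 1/4`,
`v₂(ν − 1/2) ≥ 1`). SOURCE locators: [J-IV] Prop. 6.10.9 p.69 l.1–28, (6.11.1) p.69 l.73–p.70 l.3, p.70 l.4–29 (render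
`HOME/lit/renders/Joshi-arxiv-2403.10430/`); [IUTchIV] Thm. 1.10 p.22–23 (`𝔮`, `h_v`), Cor. 2.2 (ii) proof (P5) p.46 (kurims); [GenEll] Ex. 1.3 (i)
p.5. FRAMING (binding): a located COUNTERMODEL to the E5 residual AS PRINTED with (6.11.1)'s `Σ|·|` convention, at OUR typed carriers, `d = 1`,
`ℓ = 5` — not to any author's theorem; NO side taken on [IUTchIII] Cor. 3.12 / [IUTchIV] Thm. 1.10, on Joshi's claims or on Mochizuki's report on
them; NOT an abc claim (nothing here proves or refutes abc); typed ≠ proved ≠ endorsed. Theorems only; standard axioms; FACT rows none.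
[claim: Joshi2024ATS4, status: disputed].
-/

noncomputable section

namespace Summit.ABC.IUTFork.Joshi.ATS4

open NumberField IsDedekindDomain Finset
open Literature.IUT.LogVolume Literature.IUT.LogVolume.Cor22
open Literature.NumberTheory.DiophantineGeometry Literature.NumberTheory.DiophantineGeometry.GenEll
open Literature.NumberTheory.EllipticCurves
open scoped Classical

/-! ## 1. A generic bound: `log q^{∤S}(q) ≤ log D − v_s(D)·log s` for a rational point with `j(q) = N/D` -/

/-- `log D = Σ_{p ∣ D} v_p(D)·log p` for a nonzero natural `D` (Mathlib's `Real.log_nat_eq_sum_factorization`, as a `Finset` sum over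
`D.primeFactors`). [folklore] -/
private theorem log_nat_eq_sum_primeFactors (D : ℕ) :
    Real.log D = ∑ p ∈ D.primeFactors, (D.factorization p : ℝ) * Real.log p := by
  rw [Real.log_nat_eq_sum_factorization, Finsupp.sum, Nat.support_factorization]

/-- **`log q^{∤S}(q) ≤ log D − v_s(D)·log s`** for a rational point `q` with `j(q) = N/D` (`N, D ≠ 0` naturals; NO coprimality needed) and a prime
`s ∈ S`: at a bad place `v ∤ S` the local height is `h_v = −ord_v j = v_{p_v}(D) − v_{p_v}(N) ≤ v_{p_v}(D)` and `log N(v) = log p_v`, the places of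
`ℚ` inject into the primes (`p_v`), and `Σ_{p ≠ s} v_p(D)·log p = log D − v_s(D)·log s`. [cite: Mochizuki2012, IUTchIV Thm 1.10 p.23] -/
theorem logQAvoid_ratPoint_le_log_denom {q : ℚ} {N D : ℕ} (hN : N ≠ 0) (hD : D ≠ 0) (hj : jInv q = (N : ℚ) / (D : ℚ))
    (S : Finset ℕ) {s : ℕ} (hsS : s ∈ S) :
    logQAvoid (ratPoint q) S ≤ Real.log D - (D.factorization s : ℝ) * Real.log s := by
  have h := degree_mul_logQAvoid (ratPoint q) S
  rw [degree_ratPoint, Nat.cast_one, one_mul] at h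
  rw [h]
  set T := (badPlaces (ratPoint q)).filter (fun v => ∀ p ∈ S, ((p : ℕ) : 𝓞 (ratPoint q).F) ∉ v.asIdeal) with hT
  -- the places of `(ratPoint q).F = ℚ` read as places of `ℚ`, and the prime under each
  set g : HeightOneSpectrum (𝓞 (ratPoint q).F) → ℕ :=
    fun v => Rat.HeightOneSpectrum.natGenerator (show HeightOneSpectrum (𝓞 ℚ) from v) with hg
  set f : ℕ → ℝ := fun p => (D.factorization p : ℝ) * Real.log p with hf
  -- per place: `h_v·log N(v) ≤ v_{p_v}(D)·log p_v`
  have hterm : ∀ v ∈ T, localHeight (ratPoint q) v * logNorm (ratPoint q).F v ≤ f (g v) := by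
    intro v hv
    have hbad : v ∈ badPlaces (ratPoint q) := (Finset.mem_filter.mp hv).1
    have hlog : logNorm (ratPoint q).F v = Real.log (g v) := by
      change Real.log (Ideal.absNorm (show HeightOneSpectrum (𝓞 ℚ) from v).asIdeal : ℝ) = _
      rw [UniformABCConjecture.absNorm_asIdeal_eq_natGenerator]
    have hN' : (N : ℚ) ≠ 0 := by exact_mod_cast hN
    have hD' : (D : ℚ) ≠ 0 := by exact_mod_cast hD
    have hordj : ord (ratPoint q).F v (jInv (ratPoint q).x) =
        ord ℚ (show HeightOneSpectrum (𝓞 ℚ) from v) (N : ℚ) - ord ℚ (show HeightOneSpectrum (𝓞 ℚ) from v) (D : ℚ) := by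
      change ord ℚ (show HeightOneSpectrum (𝓞 ℚ) from v) (jInv q) = _
      rw [hj, div_eq_mul_inv, ord_mul ℚ _ hN' (inv_ne_zero hD'), ord_inv]
      ring
    rw [localHeight_eq_neg_ord hbad, hlog, hordj, ord_natCast_eq_factorization _ hN, ord_natCast_eq_factorization _ hD, hf]
    have hlogp : 0 ≤ Real.log (g v) :=
      Real.log_nonneg (by exact_mod_cast (Rat.HeightOneSpectrum.prime_natGenerator (show HeightOneSpectrum (𝓞 ℚ) from v)).one_lt.le)
    refine mul_le_mul_of_nonneg_right ?_ hlogp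
    push_cast
    linarith [(Nat.cast_nonneg (N.factorization (g v)) : (0 : ℝ) ≤ _)]
  -- reindex by `p_v` (injective) and compare with `Σ_{p ∣ D, p ≠ s} v_p(D)·log p`
  have hle1 : ∑ v ∈ T, localHeight (ratPoint q) v * logNorm (ratPoint q).F v ≤ ∑ v ∈ T, f (g v) := Finset.sum_le_sum hterm
  have hginj : Function.Injective g := fun v w hvw => UniformABCConjecture.natGenerator_injective hvw
  have himg : ∑ v ∈ T, f (g v) = ∑ p ∈ T.image g, f p := (Finset.sum_image fun v _ w _ hvw => hginj hvw).symm
  have hsub : (T.image g).filter (fun p => f p ≠ 0) ⊆ D.primeFactors.erase s := by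
    intro p hp
    obtain ⟨hp, hne⟩ := Finset.mem_filter.mp hp
    obtain ⟨v, hv, rfl⟩ := Finset.mem_image.mp hp
    have hvS := (Finset.mem_filter.mp hv).2
    refine Finset.mem_erase.mpr ⟨fun heq => hvS s hsS ?_, ?_⟩
    · rw [← heq]
      exact (UniformABCConjecture.natCast_mem_asIdeal_iff (show HeightOneSpectrum (𝓞 ℚ) from v) _).mpr dvd_rfl
    · rw [← Nat.support_factorization, Finsupp.mem_support_iff]
      intro h0; exact hne (by rw [hf]; simp [h0])
  have hnonneg : ∀ p ∈ D.primeFactors.erase s, 0 ≤ f p := fun p hp =>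
    mul_nonneg (Nat.cast_nonneg _)
      (Real.log_nonneg (by exact_mod_cast (Nat.prime_of_mem_primeFactors (Finset.mem_of_mem_erase hp)).one_lt.le))
  have hle2 : ∑ p ∈ T.image g, f p ≤ ∑ p ∈ D.primeFactors.erase s, f p := by
    rw [← Finset.sum_filter_ne_zero (T.image g)]
    exact Finset.sum_le_sum_of_subset_of_nonneg hsub fun p hp _ => hnonneg p hp
  -- `Σ_{p ∣ D, p ≠ s} v_p(D)·log p = log D − v_s(D)·log s`
  have herase : ∑ p ∈ D.primeFactors.erase s, f p = Real.log D - (D.factorization s : ℝ) * Real.log s := by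
    rw [log_nat_eq_sum_primeFactors]
    by_cases hs : s ∈ D.primeFactors
    · rw [Finset.sum_erase_eq_sub hs]
    · rw [Finset.erase_eq_of_notMem hs]
      have : D.factorization s = 0 := by
        rw [← Finsupp.notMem_support_iff, Nat.support_factorization]; exact hs
      rw [this]; simp [hf]
  linarith [hle1, himg.le, hle2, herase.le]

namespace FiveSevenResidual

/-! ## 2. The point `ν_{m,n} = 5^m/(5^m + 7^n)`: the `j`-invariant, its pole at `7`, `log q^{∤{2,5}}`, the genuine `7`-components -/

/-- A natural number prime to the prime under `v` has `ord_v = 0`. [folklore] -/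
private theorem ord_natCast_eq_zero_of_not_dvd (v : HeightOneSpectrum (𝓞 ℚ)) {k : ℕ}
    (h : ¬ Rat.HeightOneSpectrum.natGenerator v ∣ k) : ord ℚ v (k : ℚ) = 0 := by
  unfold ord
  rw [(UniformABCConjecture.valuation_natCast_eq_one_iff v k).2 h, WithZero.log_one, neg_zero]

/-- **`j(ν_{m,n}) = 2⁸·(5^{2m} + 5^m·7^n + 7^{2n})³ / (5^{2m}·7^{2n}·(5^m + 7^n)²)`**: with `u = 5^m`, `v = 5^m + 7^n`, `v − u = 7^n`,
`j(u/v) = 2⁸(u² − uv + v²)³/(u²v²(v−u)²)` and `u² − uv + v² = 5^{2m} + 5^m7^n + 7^{2n}`. [cite: MochizukiGenEll2010, Ex 1.3 (i) p.5] -/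
theorem jInv_nu_eq (m n : ℕ) :
    jInv ((5 : ℚ) ^ m / (5 ^ m + 7 ^ n)) =
      ((256 * (5 ^ (2 * m) + 5 ^ m * 7 ^ n + 7 ^ (2 * n)) ^ 3 : ℕ) : ℚ) / ((5 ^ (2 * m) * 7 ^ (2 * n) * (5 ^ m + 7 ^ n) ^ 2 : ℕ) : ℚ) := by
  have h5 : (5 : ℚ) ^ m ≠ 0 := pow_ne_zero _ (by norm_num)
  have h7 : (7 : ℚ) ^ n ≠ 0 := pow_ne_zero _ (by norm_num)
  have hv : (5 : ℚ) ^ m + 7 ^ n ≠ 0 := by positivity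
  have hvu : (5 : ℚ) ^ m / (5 ^ m + 7 ^ n) - 1 = -(7 ^ n / (5 ^ m + 7 ^ n)) := by field_simp; ring
  unfold jInv
  rw [hvu]
  push_cast
  field_simp
  ring

/-- `7 ∤ 5^{2m} + 5^m·7^n + 7^{2n}` and `7 ∤ 5^m + 7^n` (`n ≥ 1`). [folklore] -/
private theorem seven_not_dvd {m n : ℕ} (hn : 1 ≤ n) :
    ¬ 7 ∣ 5 ^ (2 * m) + 5 ^ m * 7 ^ n + 7 ^ (2 * n) ∧ ¬ 7 ∣ 5 ^ m + 7 ^ n := by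
  have h7n : 7 ∣ 7 ^ n := dvd_pow_self 7 (by omega)
  have h5 : ∀ k : ℕ, ¬ 7 ∣ 5 ^ k := fun k h =>
    by have := (Nat.Prime.dvd_of_dvd_pow (by norm_num : Nat.Prime 7) h); omega
  refine ⟨fun h => h5 (2 * m) ?_, fun h => h5 m ((Nat.dvd_add_left h7n).mp h)⟩
  have h2 : 7 ∣ 5 ^ m * 7 ^ n + 7 ^ (2 * n) := Dvd.dvd.add (h7n.mul_left _) (dvd_pow_self 7 (by omega))
  have := (Nat.dvd_add_left h2).mp (by rw [← add_assoc]; exact h)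
  exact this

/-- **`ord_v j(ν_{m,n}) = −2n`** at the place `v` of `ℚ` over `7` (`n ≥ 1`): `7` divides neither `2⁸(5^{2m}+5^m7^n+7^{2n})³` nor `5^{2m}` nor
`(5^m+7^n)²`, and `ord_v(7^{2n}) = 2n`. [cite: MochizukiGenEll2010, Ex 1.3 (i) p.5] -/
theorem ord_jInv_nu (v : HeightOneSpectrum (𝓞 ℚ)) (hv : Rat.HeightOneSpectrum.natGenerator v = 7) (m : ℕ) {n : ℕ} (hn : 1 ≤ n) :
    ord ℚ v (jInv ((5 : ℚ) ^ m / (5 ^ m + 7 ^ n))) = -(2 * n : ℤ) := by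
  have h7p : Nat.Prime 7 := by norm_num
  obtain ⟨hN7, hV7⟩ := seven_not_dvd (m := m) hn
  have hA : ¬ Rat.HeightOneSpectrum.natGenerator v ∣ 256 * (5 ^ (2 * m) + 5 ^ m * 7 ^ n + 7 ^ (2 * n)) ^ 3 := by
    rw [hv]; intro h
    rcases (Nat.Prime.dvd_mul h7p).1 h with h | h
    · omega
    · exact hN7 (Nat.Prime.dvd_of_dvd_pow h7p h)
  have hB : ¬ Rat.HeightOneSpectrum.natGenerator v ∣ 5 ^ (2 * m) := by
    rw [hv]; intro h; have := Nat.Prime.dvd_of_dvd_pow h7p h; omega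
  have hC : ¬ Rat.HeightOneSpectrum.natGenerator v ∣ (5 ^ m + 7 ^ n) ^ 2 := by
    rw [hv]; intro h; exact hV7 (Nat.Prime.dvd_of_dvd_pow h7p h)
  have hA0 : ((256 * (5 ^ (2 * m) + 5 ^ m * 7 ^ n + 7 ^ (2 * n)) ^ 3 : ℕ) : ℚ) ≠ 0 := by positivity
  have hB0 : ((5 ^ (2 * m) : ℕ) : ℚ) ≠ 0 := by positivity
  have hC0 : (((5 ^ m + 7 ^ n) ^ 2 : ℕ) : ℚ) ≠ 0 := by positivity
  have h70 : (7 : ℚ) ^ (2 * n) ≠ 0 := pow_ne_zero _ (by norm_num)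
  have h7 : ord ℚ v (7 : ℚ) = 1 := by
    have := ord_natGenerator_eq_one v
    rwa [hv, Nat.cast_ofNat] at this
  have hD : ((5 ^ (2 * m) * 7 ^ (2 * n) * (5 ^ m + 7 ^ n) ^ 2 : ℕ) : ℚ) =
      ((5 ^ (2 * m) : ℕ) : ℚ) * (7 : ℚ) ^ (2 * n) * (((5 ^ m + 7 ^ n) ^ 2 : ℕ) : ℚ) := by push_cast; ring
  rw [jInv_nu_eq, hD, div_eq_mul_inv, ord_mul ℚ v hA0 (inv_ne_zero (mul_ne_zero (mul_ne_zero hB0 h70) hC0)), ord_inv,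
    ord_mul ℚ v (mul_ne_zero hB0 h70) hC0, ord_mul ℚ v hB0 h70, ord_pow, ord_natCast_eq_zero_of_not_dvd v hA,
    ord_natCast_eq_zero_of_not_dvd v hB, ord_natCast_eq_zero_of_not_dvd v hC, h7]
  push_cast
  ring

/-- `ν_{m,n} ≠ 0, 1`: the point lies in `U_P = ℙ¹ ∖ {0, 1, ∞}`. [cite: MochizukiGenEll2010, Ex 1.3 (i) p.5] -/
theorem nu_ne (m n : ℕ) : ((5 : ℚ) ^ m / (5 ^ m + 7 ^ n)) ≠ 0 ∧ ((5 : ℚ) ^ m / (5 ^ m + 7 ^ n)) ≠ 1 := by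
  have h5 : (0 : ℚ) < 5 ^ m := by positivity
  have h7 : (0 : ℚ) < 7 ^ n := by positivity
  refine ⟨(div_pos h5 (by positivity)).ne', fun h => ?_⟩
  rw [div_eq_one_iff_eq (by positivity)] at h
  linarith

/-- `ratPoint ν_{m,n} ∈ U_X(ℚ̄)^{≤1}`. [cite: MochizukiGenEll2010, Ex 1.3 (i) p.5] -/
theorem ratPoint_nu_mem_UPle_one (m n : ℕ) : ratPoint ((5 : ℚ) ^ m / (5 ^ m + 7 ^ n)) ∈ UPle 1 :=
  ratPoint_mem_UPle_one (nu_ne m n).1 (nu_ne m n).2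

/-- **`log q^{∤{2,5}}(ν_{m,n}) ≤ 2n·log 7 + 2·log(5^m + 7^n)`**: by §1 with `D = 5^{2m}·7^{2n}·(5^m+7^n)²`, `s = 5`, `v_5(D) ≥ 2m`.
[cite: Mochizuki2012, IUTchIV Cor 2.2 (ii) proof (P5) p.46] -/
theorem logQAvoid_two_five_nu_le (m n : ℕ) :
    logQAvoid (ratPoint ((5 : ℚ) ^ m / (5 ^ m + 7 ^ n))) {2, 5} ≤ 2 * n * Real.log 7 + 2 * Real.log ((5 : ℝ) ^ m + 7 ^ n) := by
  set D : ℕ := 5 ^ (2 * m) * 7 ^ (2 * n) * (5 ^ m + 7 ^ n) ^ 2 with hDdef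
  have hD0 : D ≠ 0 := by positivity
  have h := logQAvoid_ratPoint_le_log_denom (q := (5 : ℚ) ^ m / (5 ^ m + 7 ^ n)) (by positivity) hD0 (jInv_nu_eq m n) {2, 5}
    (s := 5) (by simp)
  have hfac : (2 * m : ℝ) ≤ (D.factorization 5 : ℕ) := by
    have : 2 * m ≤ D.factorization 5 :=
      ((Nat.prime_five).pow_dvd_iff_le_factorization hD0).mp (by rw [hDdef, mul_assoc]; exact Dvd.intro _ rfl)
    exact_mod_cast this
  have hlogD : Real.log (D : ℝ) = 2 * m * Real.log 5 + 2 * n * Real.log 7 + 2 * Real.log ((5 : ℝ) ^ m + 7 ^ n) := by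
    rw [hDdef]; push_cast
    rw [Real.log_mul (by positivity) (by positivity), Real.log_mul (by positivity) (by positivity), Real.log_pow, Real.log_pow, Real.log_pow]
    push_cast; ring
  have hl5 : 0 ≤ Real.log 5 := Real.log_nonneg (by norm_num)
  rw [hlogD] at h
  nlinarith

/-- `[ℚ:ℚ] = 1` for the base of `ratPoint ν_{m,n}`. [cite: MochizukiGenEll2010, Ex 1.3 (i) p.5] -/
theorem finrank_eq_one (m n : ℕ) : Module.finrank ℚ (ratPoint ((5 : ℚ) ^ m / (5 ^ m + 7 ^ n))).F = 1 := degree_ratPoint _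

/-- `ord_v j(ν_{m,n}) = −2n` at every place `v` of `ℚ` of residue characteristic `7` (`n ≥ 1`). [cite: MochizukiGenEll2010, Ex 1.3 (i) p.5] -/
theorem ord_jInv_eq (m : ℕ) {n : ℕ} (hn : 1 ≤ n) (v : HeightOneSpectrum (𝓞 (ratPoint ((5 : ℚ) ^ m / (5 ^ m + 7 ^ n))).F))
    (hv : residueChar (ratPoint ((5 : ℚ) ^ m / (5 ^ m + 7 ^ n))).F v = 7) :
    ord (ratPoint ((5 : ℚ) ^ m / (5 ^ m + 7 ^ n))).F v (jInv (ratPoint ((5 : ℚ) ^ m / (5 ^ m + 7 ^ n))).x) = -((2 * n : ℕ) : ℤ) := by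
  have h1 : ((Rat.HeightOneSpectrum.natGenerator (show HeightOneSpectrum (𝓞 ℚ) from v) : ℕ) : 𝓞 ℚ) ∈ v.asIdeal :=
    (UniformABCConjecture.natCast_mem_asIdeal_iff (show HeightOneSpectrum (𝓞 ℚ) from v) _).mpr dvd_rfl
  have h2 : residueChar (ratPoint ((5 : ℚ) ^ m / (5 ^ m + 7 ^ n))).F v =
      Rat.HeightOneSpectrum.natGenerator (show HeightOneSpectrum (𝓞 ℚ) from v) :=
    (natCast_mem_asIdeal_iff_residueChar_eq v
      (Rat.HeightOneSpectrum.prime_natGenerator (show HeightOneSpectrum (𝓞 ℚ) from v))).mp h1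
  have h := ord_jInv_nu (show HeightOneSpectrum (𝓞 ℚ) from v) (h2.symm.trans hv) m hn
  push_cast
  exact h

/-- **`7 ∈ V^dst_ℚ` is forced** over `ν_{m,n}`: for every finite `M ⊇ ℚ` and every prime `ℓ ≠ 7`, `Supp(𝔮_M)` away from `{2, ℓ}` has a place of residue
characteristic `7`. [cite: Mochizuki2012, IUTchIV Thm. 1.10 p. 23] -/
theorem exists_mem_V_residueChar_eq_seven (m : ℕ) {n : ℕ} (hn : 1 ≤ n) {ℓ : ℕ} (hℓ : ℓ.Prime) (hℓ7 : ℓ ≠ 7) (M : Type) [Field M]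
    [NumberField M] [Algebra (ratPoint ((5 : ℚ) ^ m / (5 ^ m + 7 ^ n))).F M] :
    ∃ w ∈ (TateDivisorDatum.ofNFPointOver (ratPoint ((5 : ℚ) ^ m / (5 ^ m + 7 ^ n))) {2, ℓ} M).V, residueChar M w = 7 :=
  haveI : Fact (Nat.Prime 7) := ⟨by norm_num⟩
  DegOne.exists_mem_V_residueChar_eq (m := 2 * n) (by omega) (ord_jInv_eq m hn) hℓ (by norm_num) hℓ7.symm M

/-- **`q₇ = 2n·log 7` EXACTLY** over `ν_{m,n}`, for every finite `M ⊇ ℚ` and every `S = {2, ℓ}`, `ℓ ≠ 7` prime.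
[cite: Mochizuki2012, IUTchIV Def. 1.9 (i) p. 22] -/
theorem qSeven_eq (m : ℕ) {n : ℕ} (hn : 1 ≤ n) {ℓ : ℕ} (hℓ : ℓ.Prime) (hℓ7 : ℓ ≠ 7) (M : Type) [Field M] [NumberField M]
    [Algebra (ratPoint ((5 : ℚ) ^ m / (5 ^ m + 7 ^ n))).F M] :
    (Module.finrank ℚ M : ℝ)⁻¹ *
      ∑ w ∈ (TateDivisorDatum.ofNFPointOver (ratPoint ((5 : ℚ) ^ m / (5 ^ m + 7 ^ n))) {2, ℓ} M).V with residueChar M w = 7,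
        (TateDivisorDatum.ofNFPointOver (ratPoint ((5 : ℚ) ^ m / (5 ^ m + 7 ^ n))) {2, ℓ} M).tateDivisor (Sum.inr w) * logNorm M w =
      2 * n * Real.log 7 := by
  haveI : Fact (Nat.Prime 7) := ⟨by norm_num⟩
  have h := DegOne.qComp_eq (finrank_eq_one m n) (m := 2 * n) (by omega) (ord_jInv_eq m hn) hℓ (by norm_num) hℓ7.symm M
  push_cast at h
  exact h

/-- **`d₇ ≤ log 7` on the genuine tower over `ν_{m,n}`**, for every theta field `F ⊇ ℚ`, every `K ⊇ F` Galois inside `F(E_F[ℓ])`, every prime `ℓ ≠ 7`,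
every bookkeeping set `D_K` (`7 ∤ 46080`: tame all the way). [cite: Mochizuki2012, IUTchIV Prop. 1.3 p. 12] -/
theorem dSeven_le {m n : ℕ} {F : Type} [Field F] [NumberField F] [Algebra (ratPoint ((5 : ℚ) ^ m / (5 ^ m + 7 ^ n))).F F]
    {K : Type} [Field K] [NumberField K] [Algebra F K] [Algebra (ratPoint ((5 : ℚ) ^ m / (5 ^ m + 7 ^ n))).F K]
    [IsScalarTower (ratPoint ((5 : ℚ) ^ m / (5 ^ m + 7 ^ n))).F F K] (ψ : K →ₐ[F] AlgebraicClosure F)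
    (hU : (ratPoint ((5 : ℚ) ^ m / (5 ^ m + 7 ^ n))).InU) (hF : IsThetaField (ratPoint ((5 : ℚ) ^ m / (5 ^ m + 7 ^ n))) F) [IsGalois F K]
    {ℓ : ℕ} (hℓ : ℓ.Prime) (hℓ7 : ℓ ≠ 7)
    (hK : letI := thetaCurve_isElliptic hU F
      ((thetaCurve (ratPoint ((5 : ℚ) ^ m / (5 ^ m + 7 ^ n))) F).galoisRepTorsion (ℓ : ℤ)).ker ≤ ψ.fieldRange.fixingSubgroup)
    (DK : Finset (HeightOneSpectrum (𝓞 K))) :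
    (Module.finrank ℚ K : ℝ)⁻¹ * ∑ u ∈ DK with residueChar K u = 7, differentDivisor K (Sum.inr u) * logNorm K u ≤ Real.log 7 :=
  haveI : Fact (Nat.Prime 7) := ⟨by norm_num⟩
  DegOne.dComp_le_log (finrank_eq_one m n) (by norm_num) ψ hU hF hℓ hℓ7.symm hK DK

/-! ## 3. The local excess at `p₀ = 7`, `ℓ = 5`, `d = 1`, and THE COUNTERMODEL at `ν_{m,n}` -/

/-- **The local excess at `7` beats the global cap at `ℓ = 5`, `d = 1`** (pure real arithmetic, linear in `n`): with `Q ≤ 4n·log 7 + 2·log 2` (total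
`log 𝔮_F` at `S = {2, 5}`, `5^m ≤ 7^n`), `q ≥ 2n·log 7`, `d ≤ log 7`, `E ≤ 552960 = 2¹²3³5` (`e*_mod` at `e_mod ≤ d_mod ≤ 1`), `0 ≤ ι ≤ (log 7)/7`, and
`n ≥ 10⁷`: `(1/10)·Q < (6/4)·(q/6 − (9/5)·d − (4/5)·log 7 − (20/3)·E·ι)` — with `2·log 2 ≤ log 7`, after dividing by `log 7 > 0` this follows from
`(4n+1)/10 < n/2 − 39/10 − 5529600/7`, i.e. `n > 7 899 468.6`; ratio `Q/q₇ → 2 < ℓ(ℓ+1)/12 = 5/2`. [folklore] -/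
theorem localExcess_arith_five {n Q q d E ι : ℝ} (hn : 10 ^ 7 ≤ n) (hQ : Q ≤ 4 * n * Real.log 7 + 2 * Real.log 2) (hq : 2 * n * Real.log 7 ≤ q)
    (hd : d ≤ Real.log 7) (hE : E ≤ 552960) (hι0 : 0 ≤ ι) (hι : ι ≤ Real.log 7 / 7) :
    1 / (2 * (5 : ℝ)) * Q < ((5 : ℝ) + 1) / 4 * (1 / 6 * q - (1 + 4 / (5 : ℝ)) * d - 4 / (5 : ℝ) * Real.log 7 - 20 / 3 * E * ι) := by
  have hL : 0 < Real.log 7 := Real.log_pos (by norm_num)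
  have hlog2 : 2 * Real.log 2 ≤ Real.log 7 := by
    have h := Real.log_le_log (by norm_num : (0 : ℝ) < 2 ^ 2) (by norm_num : (2 : ℝ) ^ 2 ≤ 7)
    rw [Real.log_pow] at h
    push_cast at h
    linarith
  have hEι : E * ι ≤ 552960 * (Real.log 7 / 7) := mul_le_mul hE hι hι0 (by norm_num)
  have hnL : 10 ^ 7 * Real.log 7 ≤ n * Real.log 7 := mul_le_mul_of_nonneg_right hn hL.le
  nlinarith

/-- **The GENUINE-COMPONENT residual (R4′) ∧ (R5) of `abc_of_genuineResidualSupport` (p464392 §4) is UNSATISFIABLE at the `ℚ`-point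
`ν_{m,n} = 5^m/(5^m + 7^n)` (`n ≥ 10⁷`, `5^m ≤ 7^n`; any `m ≥ 0`), `d = 1`, `ℓ = 5` (window-free).** The body below is that theorem's `∃`-body VERBATIM at
`d := 1`, `P := ratPoint ν_{m,n}`, under `ℓ = 5`. Whatever theta field `F`, division tower `K ⊆ F(E_F[5])`, `L_mod` (`e_mod ≤ d_mod ≤ 1`), `V^dst_ℚ`
(forced to contain `7`: `exists_mem_V_residueChar_eq_seven`), bookkeeping `D_K`, and local hull log-volumes the supplier returns: at `p₀ = 7` the
genuine components are `q₇ = 2n·log 7` (`qSeven_eq`) and `d₇ ≤ log 7` (`dSeven_le`), while `log 𝔮_F = log q^{∤{2,5}}(ν) ≤ 2n·log 7 + 2·log(5^m+7^n)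
≤ 4n·log 7 + 2·log 2` (Prop. 4.4.4 `logq_ofNFPointOver_eq_logQAvoid`, `logQAvoid_two_five_nu_le`), so the local excess beats the global cap
(`localExcess_arith_five`) and E-t50's `not_exists_volumes_of_localExcess` (p470440: (6.11.1) sums `|vol_p|`, no other prime absorbs it) leaves NO
`(vol, vol_∞)`. The instance `ℓ = 5` of the binder `H` itself is VACUOUS (`antecedent_instance_at_five`, p497438); this is about the `∃`-BODY, for the
reading «admissible = `InitialThetaData.five_le_l`». A located COUNTERMODEL to the E5 residual AS PRINTED with (6.11.1)'s `Σ|·|` convention, `d = 1` —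
not to any author's theorem; NO side taken on [IUTchIII] Cor. 3.12 / [IUTchIV] Thm. 1.10; NOT an abc claim. [claim: Joshi2024ATS4, status: disputed] -/
theorem genuineResidualSupport_unsat_five {m n : ℕ} (hn : 10 ^ 7 ≤ n) (hle : 5 ^ m ≤ 7 ^ n) {ℓ : ℕ} (hℓ5 : ℓ = 5) :
    ¬ ∃ (F : Type) (_ : Field F) (_ : NumberField F) (_ : Algebra (ratPoint ((5 : ℚ) ^ m / (5 ^ m + 7 ^ n))).F F)
          (K : Type) (_ : Field K) (_ : NumberField K) (_ : Algebra F K) (_ : Algebra (ratPoint ((5 : ℚ) ^ m / (5 ^ m + 7 ^ n))).F K)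
          (_ : IsScalarTower (ratPoint ((5 : ℚ) ^ m / (5 ^ m + 7 ^ n))).F F K)
          (_ : IsGalois F K) (ψ : K →ₐ[F] AlgebraicClosure F) (hU : (ratPoint ((5 : ℚ) ^ m / (5 ^ m + 7 ^ n))).InU)
          (_ : IsThetaField (ratPoint ((5 : ℚ) ^ m / (5 ^ m + 7 ^ n))) F)
          (_ : letI := thetaCurve_isElliptic hU F
            ((thetaCurve (ratPoint ((5 : ℚ) ^ m / (5 ^ m + 7 ^ n))) F).galoisRepTorsion (ℓ : ℤ)).ker ≤ ψ.fieldRange.fixingSubgroup)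
          (_ : 0 < (TateDivisorDatum.ofNFPointOver (ratPoint ((5 : ℚ) ^ m / (5 ^ m + 7 ^ n))) {2, ℓ} F).logq)
          (Lmod : Type) (_ : Field Lmod) (_ : NumberField Lmod) (_ : Cor22.dmod (ratPoint ((5 : ℚ) ^ m / (5 ^ m + 7 ^ n))) ≤ dMod Lmod)
          (_ : dMod Lmod ≤ 1)
          (V : Finset ℕ)
          (_ : ∀ q ∈ V, q.Prime ∧ (q ∣ 2 * 3 * 5 * ℓ ∨
            (∃ v ∈ badPlacesAvoid (ratPoint ((5 : ℚ) ^ m / (5 ^ m + 7 ^ n))) {2, ℓ},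
              residueChar (ratPoint ((5 : ℚ) ^ m / (5 ^ m + 7 ^ n))).F v = q) ∨
            ∃ u : HeightOneSpectrum (𝓞 K), residueChar K u = q ∧ 2 ≤ u.asIdeal.ramificationIdx ℤ))
          (_ : ∀ u : HeightOneSpectrum (𝓞 K), 2 ≤ u.asIdeal.ramificationIdx ℤ → residueChar K u ∈ V)
          (_ : ∀ w ∈ (TateDivisorDatum.ofNFPointOver (ratPoint ((5 : ℚ) ^ m / (5 ^ m + 7 ^ n))) {2, ℓ} F).V, residueChar F w ∈ V)
          (DK : Finset (HeightOneSpectrum (𝓞 K))) (_ : ∀ u, differentDivisor K (Sum.inr u) ≠ 0 → u ∈ DK)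
          (vol : ℕ → ℝ) (volArch : ℝ),
          (∀ p ∈ V, -(1 / (((ℓ : ℝ) - 1) / 2)) * |vol p| ≤ ((ℓ : ℝ) + 1) / 4 *
            ((1 + 4 / (ℓ : ℝ)) *
                ((Module.finrank ℚ K : ℝ)⁻¹ *
                  ∑ u ∈ DK with residueChar K u = p, differentDivisor K (Sum.inr u) * logNorm K u)
              - 1 / 6 *
                ((Module.finrank ℚ F : ℝ)⁻¹ *
                  ∑ w ∈ (TateDivisorDatum.ofNFPointOver (ratPoint ((5 : ℚ) ^ m / (5 ^ m + 7 ^ n))) {2, ℓ} F).V with residueChar F w = p,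
                    (TateDivisorDatum.ofNFPointOver (ratPoint ((5 : ℚ) ^ m / (5 ^ m + 7 ^ n))) {2, ℓ} F).tateDivisor (Sum.inr w) *
                      logNorm F w)
              + 4 / (ℓ : ℝ) * Real.log p
              + 20 / 3 * ((2 ^ 12 * 3 ^ 3 * 5 * eMod Lmod : ℕ) : ℝ) *
                (if p ≤ 2 ^ 12 * 3 ^ 3 * 5 * eMod Lmod * ℓ then Real.log p / p else 0))) ∧
          -(1 / (2 * (ℓ : ℝ)) * (TateDivisorDatum.ofNFPointOver (ratPoint ((5 : ℚ) ^ m / (5 ^ m + 7 ^ n))) {2, ℓ} F).logq) ≤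
            -(1 / (((ℓ : ℝ) - 1) / 2)) * (∑ p ∈ V, |vol p| + |volArch|) := by
  subst hℓ5
  rintro ⟨F, _, _, _, K, _, _, _, _, _, _, ψ, hU, hF, hK, -, Lmod, _, _, -, hdmod, V, -, -, hbad, DK, -, vol, volArch,
    hStepV, hLower⟩
  have hn1 : 1 ≤ n := le_trans (by norm_num) hn
  have hℓ : (5 : ℕ).Prime := by norm_num
  -- `7 ∈ V^dst_ℚ`
  obtain ⟨w₇, hw₇, hres₇⟩ := exists_mem_V_residueChar_eq_seven m hn1 hℓ (by norm_num) F
  have h7V : 7 ∈ V := hres₇ ▸ hbad w₇ hw₇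
  -- the three genuine numbers at `p₀ = 7`
  have hq7 := qSeven_eq m hn1 hℓ (by norm_num) F
  have hd7 := dSeven_le ψ hU hF hℓ (by norm_num) hK DK
  have hQ : (TateDivisorDatum.ofNFPointOver (ratPoint ((5 : ℚ) ^ m / (5 ^ m + 7 ^ n))) {2, 5} F).logq ≤ 4 * n * Real.log 7 + 2 * Real.log 2 := by
    rw [TateDivisorDatum.logq_ofNFPointOver_eq_logQAvoid]
    refine (logQAvoid_two_five_nu_le m n).trans ?_
    have hsum : (5 : ℝ) ^ m + 7 ^ n ≤ 2 * 7 ^ n := by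
      have : ((5 ^ m : ℕ) : ℝ) ≤ ((7 ^ n : ℕ) : ℝ) := by exact_mod_cast hle
      push_cast at this; linarith
    have hlog : Real.log ((5 : ℝ) ^ m + 7 ^ n) ≤ Real.log 2 + n * Real.log 7 := by
      rw [← Real.log_pow, ← Real.log_mul (by norm_num) (by positivity)]
      exact Real.log_le_log (by positivity) hsum
    linarith
  -- the Mertens coefficient `e*_mod ≤ 2¹²3³5` and weight `ι₇ ≤ (log 7)/7`
  have hE : (((2 ^ 12 * 3 ^ 3 * 5 * eMod Lmod : ℕ) : ℝ)) ≤ 552960 := by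
    have h := (eMod_le_dMod (Lmod := Lmod)).trans hdmod
    have : ((eMod Lmod : ℕ) : ℝ) ≤ 1 := by exact_mod_cast h
    push_cast; nlinarith
  have hι : ∀ N : ℕ, (0 : ℝ) ≤ (if 7 ≤ N then Real.log 7 / 7 else 0) ∧ (if 7 ≤ N then Real.log 7 / 7 else 0) ≤ Real.log 7 / 7 := by
    intro N
    have : 0 ≤ Real.log 7 / 7 := div_nonneg (Real.log_nonneg (by norm_num)) (by norm_num)
    split_ifs <;> exact ⟨by positivity, by linarith⟩
  refine not_exists_volumes_of_localExcess 5 (by norm_num) V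
    (fun p => (Module.finrank ℚ K : ℝ)⁻¹ * ∑ u ∈ DK with residueChar K u = p, differentDivisor K (Sum.inr u) * logNorm K u)
    (fun p => (Module.finrank ℚ F : ℝ)⁻¹ *
      ∑ w ∈ (TateDivisorDatum.ofNFPointOver (ratPoint ((5 : ℚ) ^ m / (5 ^ m + 7 ^ n))) {2, 5} F).V with residueChar F w = p,
        (TateDivisorDatum.ofNFPointOver (ratPoint ((5 : ℚ) ^ m / (5 ^ m + 7 ^ n))) {2, 5} F).tateDivisor (Sum.inr w) * logNorm F w)
    ((2 ^ 12 * 3 ^ 3 * 5 * eMod Lmod : ℕ) : ℝ) _ (2 ^ 12 * 3 ^ 3 * 5 * eMod Lmod * 5) h7V ?_ ⟨vol, volArch, hStepV, hLower⟩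
  have h7 : ((7 : ℕ) : ℝ) = 7 := by norm_num
  have h5 : ((5 : ℕ) : ℝ) = 5 := by norm_num
  simp only [h7, h5]
  exact localExcess_arith_five (by exact_mod_cast hn) hQ hq7.ge hd7 hE (hι _).1 (hι _).2

end FiveSevenResidual

end Summit.ABC.IUTFork.Joshi.ATS4

end
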